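import Summits.BirchSwinnertonDyer.Rank1Residual.X2.RouteGThreeTorsionCount
import Summits.BirchSwinnertonDyer.BirchSwinnertonDyer.Theorems.Rank1ResidualIntModelReduction
import Literature.NumberTheory.EllipticCurves.BinaryQuarticFiniteFieldSolubilityProofs
import HarnessLib

/-!
# Route G at `p = 3`: `3 ∣ #Ẽ(𝔽_ℓ)` from an EXPLICIT point of order `3` over `𝔽_ℓ` — no kernel point count
# (cell `bsd-eis`, seat `bsd-eis-k5-c3` g2; THEOREMS ONLY, nothing booked)

HONEST FRAMING (FULL-BSD rank-≤1 programme D-0033, cell `bsd-eis`; row A10). The route-G displays evaluate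
Greenberg–Vatsal's local invariant `d_ℓ` at a GOOD place `ℓ ≠ 3` of one curve from `3 ∣ ℓ + 1 − a_ℓ = #Ẽ(𝔽_ℓ)`
(`X2/LocalDeltaCalculus.lean`). `X2/RouteGThreeTorsionCount.lean` (ky g4) removed the kernel point count when the
curve has a RATIONAL point of order `3`. The non-split A10 targets have none (their rational `3`-isogeny kernel is
`{O, ±P}` with `P` defined over a real quadratic field), and their relatives found OUTSIDE Cremona's table have bad
primes far beyond the reach of a kernel point count. This file gives the count-free certificate that still applies:
an explicit point `(x̄, ȳ) ∈ Ẽ(𝔽_ℓ)` with `Ψ₃(x̄) = 0`, `Ψ₂Sq(x̄) ≠ 0` has order exactly `3` (Silverman III Ex. 3.7,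
the tree's `three_smul_some_eq_zero_iff` over ANY field), so `3 ∣ #Ẽ(𝔽_ℓ) = ℓ + 1 − a_ℓ` (Lagrange). For a curve with a
rational `3`-isogeny of kernel `{O, ±P}`, `x(P) ∈ ℚ`, such a point exists at every good `ℓ` where `y(P)` reduces into
`𝔽_ℓ` (half of the primes), and at the other good `ℓ ≡ 2 (mod 3)` some other root of `Ψ₃ mod ℓ` carries one.
* `addOrderOf_eq_three_of_eval_Ψ₃_field` — the order-`3` criterion over an arbitrary field;
* `three_dvd_natCard_point_of_eval_Ψ₃` — `3 ∣ #W(F)` over a finite field;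
* `three_dvd_natGenerator_add_one_sub_frobeniusTraceAt_of_modPoint` — the display form: for a globally minimal `W/ℚ`
  with integer model `E₀` and a prime `ℓ`, a point of order `3` on `E₀ mod ℓ` gives `3 ∣ ℓ(v) + 1 − a_v(W)` at the
  place `v` of `ℓ` (the hypothesis `hdvd` of `dMultiplicity_of_hasGoodReductionAt_of_dvd`).
References: [SilvermanAEC2009] III Ex. 3.7, V.§1; [GreenbergVatsal2000] §2 Prop. (2.4).
-/

set_option autoImplicit false

noncomputable section

open scoped Classical

open WeierstrassCurve NumberField IsDedekindDomain Literature.NumberTheory.EllipticCurves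
  Summit.BirchSwinnertonDyer.BirchSwinnertonDyer.Rank1Residual.IntModel

namespace Summit.BirchSwinnertonDyer.Rank1Residual.X2.RouteGThreeTorsion

/-- **A nonsingular point `(x₀, y₀)` with `Ψ₃(x₀) = 0` and `Ψ₂Sq(x₀) ≠ 0` has order exactly `3`, over ANY field**
(`3·P = O` by the division polynomial, `P ≠ O`; Silverman III Ex. 3.7; the field-generic form of
`addOrderOf_eq_three_of_eval_Ψ₃`). [cite: SilvermanAEC2009, III Ex. 3.7] -/
theorem addOrderOf_eq_three_of_eval_Ψ₃_field {F : Type*} [Field F] [DecidableEq F] (V : WeierstrassCurve F)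
    {x₀ y₀ : F} (hP : V.toAffine.Nonsingular x₀ y₀) (hψ : V.Ψ₃.eval x₀ = 0) (hd : V.Ψ₂Sq.eval x₀ ≠ 0) :
    addOrderOf (Affine.Point.some x₀ y₀ hP) = 3 := by
  have hy : y₀ ≠ V.toAffine.negY x₀ y₀ := by
    intro e
    apply hd
    rw [← sub_negY_sq_eq_eval_Ψ₂Sq _ hP.left, sub_eq_zero.mpr e, zero_pow two_ne_zero]
  have h3 : (3 : ℤ) • (Affine.Point.some x₀ y₀ hP) = 0 :=
    (WeierstrassCurve.three_smul_some_eq_zero_iff (V := V) hP hy).mpr (by rw [ψ_three, Polynomial.evalEval_C, hψ])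
  have h3' : (3 : ℕ) • (Affine.Point.some x₀ y₀ hP) = 0 := by
    rw [← natCast_zsmul]; exact_mod_cast h3
  haveI : Fact (Nat.Prime 3) := ⟨Nat.prime_three⟩
  exact addOrderOf_eq_prime h3' (Affine.Point.some_ne_zero hP)

/-- **`3 ∣ #W(F)` over a finite field `F` from an explicit point of order `3`** (Lagrange). [cite: SilvermanAEC2009, III Ex. 3.7] -/
theorem three_dvd_natCard_point_of_eval_Ψ₃ {F : Type*} [Field F] [Finite F] [DecidableEq F]
    (V : WeierstrassCurve F) {x₀ y₀ : F} (hP : V.toAffine.Nonsingular x₀ y₀) (hψ : V.Ψ₃.eval x₀ = 0)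
    (hd : V.Ψ₂Sq.eval x₀ ≠ 0) : 3 ∣ Nat.card V.toAffine.Point := by
  haveI := BinaryQuartic.finite_point V
  exact addOrderOf_eq_three_of_eval_Ψ₃_field V hP hψ hd ▸ addOrderOf_dvd_natCard _

/-- **`3 ∣ ℓ + 1 − a_ℓ = #Ẽ(𝔽_ℓ)` at the place of a prime `ℓ` from a point of order `3` on the integer model mod `ℓ`**
(globally minimal `W` with integer model `E₀`; `a_ℓ(W) = ℓ + 1 − #(E₀ mod ℓ)(𝔽_ℓ)` is the tree's `frobeniusTrace_eq`) —
the hypothesis of `dMultiplicity_of_hasGoodReductionAt_of_dvd` at `p = 3`, obtained WITHOUT a point count and WITHOUT a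
rational `3`-torsion point. [cite: SilvermanAEC2009, III Ex. 3.7] [cite: GreenbergVatsal2000, §2 Prop. (2.4)] -/
theorem three_dvd_natGenerator_add_one_sub_frobeniusTraceAt_of_modPoint (W : WeierstrassCurve ℚ) [W.IsElliptic]
    [W.IsGloballyMinimal] {E₀ : WeierstrassCurve ℤ} (hI : integralModelInt W = E₀) (ℓ : ℕ) (hℓ : ℓ.Prime)
    {x₀ y₀ : ZMod ℓ} (hP : (E₀.map (Int.castRingHom (ZMod ℓ))).toAffine.Nonsingular x₀ y₀)
    (hψ : (E₀.map (Int.castRingHom (ZMod ℓ))).Ψ₃.eval x₀ = 0)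
    (hd : (E₀.map (Int.castRingHom (ZMod ℓ))).Ψ₂Sq.eval x₀ ≠ 0) :
    ((3 : ℕ) : ℤ) ∣ (Rat.HeightOneSpectrum.natGenerator
        ((Rat.HeightOneSpectrum.primesEquiv (R := 𝓞 ℚ)).symm ⟨ℓ, hℓ⟩) + 1 -
      W.frobeniusTraceAt ((Rat.HeightOneSpectrum.primesEquiv (R := 𝓞 ℚ)).symm ⟨ℓ, hℓ⟩) : ℤ) := by
  haveI : Fact ℓ.Prime := ⟨hℓ⟩
  have hdvd : 3 ∣ Nat.card ((E₀.map (Int.castRingHom (ZMod ℓ))).toAffine.Point) :=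
    three_dvd_natCard_point_of_eval_Ψ₃ _ hP hψ hd
  have hgen : Rat.HeightOneSpectrum.natGenerator
      ((Rat.HeightOneSpectrum.primesEquiv (R := 𝓞 ℚ)).symm ⟨ℓ, hℓ⟩) = ℓ :=
    congrArg Subtype.val (Equiv.apply_symm_apply (Rat.HeightOneSpectrum.primesEquiv (R := 𝓞 ℚ)) _)
  have hev : Rat.HeightOneSpectrum.primesEquiv (R := 𝓞 ℚ)
      ((Rat.HeightOneSpectrum.primesEquiv (R := 𝓞 ℚ)).symm ⟨ℓ, hℓ⟩) = ⟨ℓ, hℓ⟩ := Equiv.apply_symm_apply _ _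
  rw [hgen, WeierstrassCurve.frobeniusTraceAt_eq_frobeniusTrace, hev]
  show ((3 : ℕ) : ℤ) ∣ (ℓ : ℤ) + 1 - W.frobeniusTrace ℓ
  rw [frobeniusTrace_eq hI rfl]
  rw [show (ℓ : ℤ) + 1 - ((ℓ : ℤ) + 1 - (Nat.card ((E₀.map (Int.castRingHom (ZMod ℓ))).toAffine.Point) : ℤ)) =
      (Nat.card ((E₀.map (Int.castRingHom (ZMod ℓ))).toAffine.Point) : ℤ) by ring]
  exact_mod_cast hdvd

end Summit.BirchSwinnertonDyer.Rank1Residual.X2.RouteGThreeTorsion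

end
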